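import Literature.NumberTheory.CubicFields.DeloneFaddeevCorrespondence
import Mathlib.LinearAlgebra.Matrix.GeneralLinearGroup.Defs
import Mathlib.LinearAlgebra.Matrix.ToLinearEquiv
import Mathlib.GroupTheory.GroupAction.Defs
import HarnessLib

/-!
# `Stab_{GL₂(ℤ)}(f) ≅ Aut(R(f))` (Levi–Delone–Faddeev, the automorphism clause)

Topic `Literature/NumberTheory/CubicFields`, continuing `DeloneFaddeevCorrespondence.lean`.

Bhargava–Taniguchi–Thorne 2023, Thm 2.1, last clause: "if a cubic form `f` corresponds to a cubic
ring `R`, then `Stab_{GL₂(ℤ)}(f)` is isomorphic to `Aut(R)`" — for the twisted action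
`(γ · f)(u,v) = det(γ)⁻¹ f((u,v)γ)` of §2.2 (8). This file proves it for `R = R(f)`:

* the twisted action as a `MulAction` of `GL₂(ℤ) = GL (Fin 2) ℤ` on `V(ℤ) = BinaryCubic ℤ`
  (`gl_smul_def`), so that `Stab_{GL₂(ℤ)}(f)` is Mathlib's `MulAction.stabilizer (GL (Fin 2) ℤ) f`;
* `RingOfForm.autMatrix φ` — the matrix of `φ⁻¹` on `R(f)/ℤ·1 = ℤω ⊕ ℤθ` (rows: the
  `(ω, θ)`-coordinates of `φ⁻¹(ω)`, `φ⁻¹(θ)`); it is the transition matrix from the basis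
  `(1, ω, θ)` to its transport by `φ⁻¹` (`autMatrix_eq_transition`), hence unimodular and it FIXES
  `f` (`twist_autMatrix`: the index form of both bases is `f`);
* `RingOfForm.autToGL : RingAut R(f) →* GL₂(ℤ)` — a group homomorphism (`autMatrix_mul`), injective
  (`autToGL_injective`: an automorphism with `φ(ω) ≡ ω`, `φ(θ) ≡ θ (mod ℤ)` is the identity, by
  `ωθ ∈ ℤ`), with image exactly the stabilizer (`range_autToGL`: a `γ ∈ Stab(f)` is realized by the
  basis `(1, γ₀₀ω + γ₀₁θ, γ₁₀ω + γ₁₁θ)`, whose index form is `γ · f = f`, and the explicit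
  isomorphism `R(f) = R(indexForm) ≅ R(f)` of `DeloneFaddeevSurjective`);
* `RingOfForm.autEquivStab : RingAut R(f) ≃* stabilizer (GL (Fin 2) ℤ) f` and
  **`RingOfForm.stabEquivAut : Stab_{GL₂(ℤ)}(f) ≃* Aut(R(f))`** (BTT Thm 2.1, last clause).

## References

* M. Bhargava, T. Taniguchi, F. Thorne, *Improved error estimates for the Davenport–Heilbronn
  theorems*, Math. Ann. 389 (2024) = arXiv:2107.12819, Thm 2.1 [BhargavaTaniguchiThorne2023].
* M. Bhargava, A. Shankar, J. Tsimerman, *On the Davenport–Heilbronn theorems and second order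
  terms*, Invent. Math. 193 (2013), §2 [BhargavaShankarTsimerman2012].
* W. T. Gan, B. Gross, G. Savin, *Fourier coefficients of modular forms on `G₂`*, Duke Math. J.
  115 (2002), §4, Prop. 4.2 [GanGrossSavin2002].
-/

namespace Literature.NumberTheory.CubicFields

open Module BinaryCubic

/-! ### The twisted action of `GL₂(ℤ)` on `V(ℤ)` and the stabilizer -/

/-- **The twisted action of `GL₂(ℤ)` on integral binary cubic forms** (BTT 2023, §2.2 (8):
`(γ · f)(u, v) = det(γ)⁻¹ f((u, v)γ)`), as a `MulAction` of Mathlib's `GL (Fin 2) ℤ`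
(`γ • f = twist ↑γ f`). [cite: BhargavaTaniguchiThorne2023, §2.2 (8)] -/
noncomputable instance : MulAction (GL (Fin 2) ℤ) (BinaryCubic ℤ) where
  smul γ f := twist (γ : Matrix (Fin 2) (Fin 2) ℤ) f
  one_smul f := by
    change twist ((1 : GL (Fin 2) ℤ) : Matrix (Fin 2) (Fin 2) ℤ) f = f
    rw [Units.val_one, twist_one]
  mul_smul γ δ f := by
    change twist ((γ * δ : GL (Fin 2) ℤ) : Matrix (Fin 2) (Fin 2) ℤ) f = twist (γ : Matrix _ _ ℤ) (twist _ f)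
    rw [Units.val_mul, twist_mul]

/-- `γ • f = twist γ f`. [folklore] -/
theorem gl_smul_def (γ : GL (Fin 2) ℤ) (f : BinaryCubic ℤ) :
    γ • f = twist (γ : Matrix (Fin 2) (Fin 2) ℤ) f := rfl

/-- Membership in `Stab_{GL₂(ℤ)}(f)`: `twist γ f = f`. [folklore] -/
theorem mem_stabilizer_iff_twist (γ : GL (Fin 2) ℤ) (f : BinaryCubic ℤ) :
    γ ∈ MulAction.stabilizer (GL (Fin 2) ℤ) f ↔ twist (γ : Matrix (Fin 2) (Fin 2) ℤ) f = f :=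
  MulAction.mem_stabilizer_iff

/-- Forms in one `GL₂(ℤ)`-orbit (for the group action) are `GL2ZEquiv`alent and conversely. [folklore] -/
theorem gl2zEquiv_iff_exists_smul (f g : BinaryCubic ℤ) : GL2ZEquiv f g ↔ ∃ γ : GL (Fin 2) ℤ, γ • f = g := by
  constructor
  · rintro ⟨γ, hγ, rfl⟩
    exact ⟨Matrix.GeneralLinearGroup.mk'' γ hγ, rfl⟩
  · rintro ⟨γ, rfl⟩
    exact ⟨γ, Matrix.isUnits_det_units γ, rfl⟩

namespace RingOfForm

variable {f g : BinaryCubic ℤ}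

/-! ### Ring homomorphisms out of `R(f)` in coordinates -/

section Coordinates

variable {F : Type*} [FunLike F (RingOfForm f) (RingOfForm g)] [RingHomClass F (RingOfForm f) (RingOfForm g)]

/-- A ring homomorphism out of `R(f)` is determined by the images of `ω` and `θ`:
`χ(x + yω + zθ) = x + y χ(ω) + z χ(θ)`. [folklore] -/
theorem ringHom_apply_eq (χ : F) (P : RingOfForm f) :
    χ P = (P.x : RingOfForm g) + (P.y : RingOfForm g) * χ (omega f) + (P.z : RingOfForm g) * χ (theta f) := by
  conv_lhs => rw [eq_coord_combination P]
  simp only [map_add, map_mul, map_intCast]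

/-- The `1`-coordinate of `χ(P)`. [folklore] -/
theorem ringHom_apply_x (χ : F) (P : RingOfForm f) :
    (χ P).x = P.x + P.y * (χ (omega f)).x + P.z * (χ (theta f)).x := by
  rw [ringHom_apply_eq]; simp

/-- The `ω`-coordinate of `χ(P)`. [folklore] -/
theorem ringHom_apply_y (χ : F) (P : RingOfForm f) :
    (χ P).y = P.y * (χ (omega f)).y + P.z * (χ (theta f)).y := by
  rw [ringHom_apply_eq]; simp

/-- The `θ`-coordinate of `χ(P)`. [folklore] -/
theorem ringHom_apply_z (χ : F) (P : RingOfForm f) :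
    (χ P).z = P.y * (χ (omega f)).z + P.z * (χ (theta f)).z := by
  rw [ringHom_apply_eq]; simp

end Coordinates

/-- A ring endomorphism of `R(f)` fixing `ω` and `θ` is the identity map. [folklore] -/
theorem ringHom_apply_of_fix {F : Type*} [FunLike F (RingOfForm f) (RingOfForm f)]
    [RingHomClass F (RingOfForm f) (RingOfForm f)] (χ : F) (hω : χ (omega f) = omega f)
    (hθ : χ (theta f) = theta f) (P : RingOfForm f) : χ P = P := by
  rw [ringHom_apply_eq χ P, hω, hθ, ← eq_coord_combination P]

/-- `castRingEquiv` is the identity on coordinates. [folklore] -/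
@[simp] theorem castRingEquiv_apply_x {F G : BinaryCubic ℤ} (h : F = G) (P : RingOfForm F) :
    (castRingEquiv h P).x = P.x := by
  subst h; rfl
/-- `castRingEquiv` is the identity on coordinates. [folklore] -/
@[simp] theorem castRingEquiv_apply_y {F G : BinaryCubic ℤ} (h : F = G) (P : RingOfForm F) :
    (castRingEquiv h P).y = P.y := by
  subst h; rfl
/-- `castRingEquiv` is the identity on coordinates. [folklore] -/
@[simp] theorem castRingEquiv_apply_z {F G : BinaryCubic ℤ} (h : F = G) (P : RingOfForm F) :
    (castRingEquiv h P).z = P.z := by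
  subst h; rfl
/-- `castRingEquiv.symm` is the identity on coordinates. [folklore] -/
@[simp] theorem castRingEquiv_symm_apply_x {F G : BinaryCubic ℤ} (h : F = G) (P : RingOfForm G) :
    ((castRingEquiv h).symm P).x = P.x := by
  subst h; rfl
/-- `castRingEquiv.symm` is the identity on coordinates. [folklore] -/
@[simp] theorem castRingEquiv_symm_apply_y {F G : BinaryCubic ℤ} (h : F = G) (P : RingOfForm G) :
    ((castRingEquiv h).symm P).y = P.y := by
  subst h; rfl
/-- `castRingEquiv.symm` is the identity on coordinates. [folklore] -/
@[simp] theorem castRingEquiv_symm_apply_z {F G : BinaryCubic ℤ} (h : F = G) (P : RingOfForm G) :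
    ((castRingEquiv h).symm P).z = P.z := by
  subst h; rfl

/-! ### The matrix of an automorphism on `R(f)/ℤ` -/

/-- The matrix of the automorphism `φ` of `R(f)`: the `(ω, θ)`-coordinates of `φ⁻¹(ω)` (first row)
and of `φ⁻¹(θ)` (second row), i.e. the matrix of `φ⁻¹` on `R(f)/ℤ·1` in the row convention of
`transition` — the element of `GL₂(ℤ)` attached to `φ` (with `φ⁻¹` so that `φ ↦ autMatrix φ` is a
homomorphism for `(φψ)(x) = φ(ψ(x))`). [folklore] -/
def autMatrix (φ : RingAut (RingOfForm f)) : Matrix (Fin 2) (Fin 2) ℤ :=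
  !![(φ.symm (omega f)).y, (φ.symm (omega f)).z; (φ.symm (theta f)).y, (φ.symm (theta f)).z]

/-- Entries of `autMatrix`. [folklore] -/
@[simp] theorem autMatrix_apply_zero_zero (φ : RingAut (RingOfForm f)) : autMatrix φ 0 0 = (φ.symm (omega f)).y := rfl
/-- Entries of `autMatrix`. [folklore] -/
@[simp] theorem autMatrix_apply_zero_one (φ : RingAut (RingOfForm f)) : autMatrix φ 0 1 = (φ.symm (omega f)).z := rfl
/-- Entries of `autMatrix`. [folklore] -/
@[simp] theorem autMatrix_apply_one_zero (φ : RingAut (RingOfForm f)) : autMatrix φ 1 0 = (φ.symm (theta f)).y := rfl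
/-- Entries of `autMatrix`. [folklore] -/
@[simp] theorem autMatrix_apply_one_one (φ : RingAut (RingOfForm f)) : autMatrix φ 1 1 = (φ.symm (theta f)).z := rfl

/-- The basis `(1, ω, θ)` transported by the automorphism `φ⁻¹`. [folklore] -/
noncomputable def autBasis (φ : RingAut (RingOfForm f)) : Basis (Fin 3) ℤ (RingOfForm f) :=
  (basis f).map φ.symm.toAddEquiv.toIntLinearEquiv

/-- `autBasis φ i = φ⁻¹ (basis f i)`. [folklore] -/
@[simp] theorem autBasis_apply (φ : RingAut (RingOfForm f)) (i : Fin 3) :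
    autBasis φ i = φ.symm (basis f i) := by
  simp [autBasis]

/-- `autMatrix φ` is the transition matrix from `(1, ω, θ)` to `φ⁻¹(1, ω, θ)`. [folklore] -/
theorem autMatrix_eq_transition (φ : RingAut (RingOfForm f)) :
    autMatrix φ = transition (basis f) (autBasis φ) := by
  ext i j
  fin_cases i <;> fin_cases j <;> simp [transition_apply]

/-- **`autMatrix φ ∈ GL₂(ℤ)`.** [folklore] -/
theorem isUnit_det_autMatrix (φ : RingAut (RingOfForm f)) : IsUnit (autMatrix φ).det := by
  rw [autMatrix_eq_transition]
  exact isUnit_det_transition _ _ basis_zero (by simp)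

/-- **`autMatrix φ` stabilizes `f`**: the index form of the transported basis `φ⁻¹(1, ω, θ)` is
again `f` (isomorphism invariance), and it is `(autMatrix φ) · f` (change of basis). [folklore] -/
theorem twist_autMatrix (φ : RingAut (RingOfForm f)) : twist (autMatrix φ) f = f := by
  have h := indexForm_eq_twist_transition (basis f) (autBasis φ) basis_zero (by simp)
  rw [← autMatrix_eq_transition] at h
  rw [autBasis, indexForm_map, indexForm_basis] at h
  exact h.symm

/-- `autMatrix 1 = 1`. [folklore] -/
@[simp] theorem autMatrix_one : autMatrix (1 : RingAut (RingOfForm f)) = 1 := by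
  have h1 : (1 : RingAut (RingOfForm f)).symm = 1 := inv_one
  ext i j
  fin_cases i <;> fin_cases j <;> simp [autMatrix, h1]

/-- **`φ ↦ autMatrix φ` is multiplicative.** [folklore] -/
theorem autMatrix_mul (φ ψ : RingAut (RingOfForm f)) : autMatrix (φ * ψ) = autMatrix φ * autMatrix ψ := by
  have hinv : ∀ x, (φ * ψ).symm x = ψ.symm (φ.symm x) := fun x => rfl
  have e00 := ringHom_apply_y ψ.symm (φ.symm (omega f))
  have e01 := ringHom_apply_z ψ.symm (φ.symm (omega f))
  have e10 := ringHom_apply_y ψ.symm (φ.symm (theta f))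
  have e11 := ringHom_apply_z ψ.symm (φ.symm (theta f))
  ext i j
  fin_cases i <;> fin_cases j <;>
    simp [autMatrix, Matrix.mul_apply, Fin.sum_univ_two, hinv, e00, e01, e10, e11]

/-- **The homomorphism `Aut(R(f)) → GL₂(ℤ)`**, `φ ↦ autMatrix φ`. [folklore] -/
noncomputable def autToGL (f : BinaryCubic ℤ) : RingAut (RingOfForm f) →* GL (Fin 2) ℤ where
  toFun φ := Matrix.GeneralLinearGroup.mk'' (autMatrix φ) (isUnit_det_autMatrix φ)
  map_one' := Units.ext (show autMatrix 1 = ((1 : GL (Fin 2) ℤ) : Matrix (Fin 2) (Fin 2) ℤ) by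
    rw [autMatrix_one, Units.val_one])
  map_mul' φ ψ := Units.ext (show autMatrix (φ * ψ) = autMatrix φ * autMatrix ψ from autMatrix_mul φ ψ)

/-- The underlying matrix of `autToGL f φ`. [folklore] -/
@[simp] theorem coe_autToGL (φ : RingAut (RingOfForm f)) :
    ((autToGL f φ : GL (Fin 2) ℤ) : Matrix (Fin 2) (Fin 2) ℤ) = autMatrix φ := rfl

/-- **The image lies in the stabilizer of `f`.** [folklore] -/
theorem autToGL_mem_stabilizer (φ : RingAut (RingOfForm f)) :
    autToGL f φ ∈ MulAction.stabilizer (GL (Fin 2) ℤ) f := by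
  rw [mem_stabilizer_iff_twist, coe_autToGL, twist_autMatrix]

/-- **Injectivity**: an automorphism acting trivially on `R(f)/ℤ·1` is trivial. If
`φ⁻¹(ω) = u + ω` and `φ⁻¹(θ) = v + θ` then `−ad = φ⁻¹(ωθ) = (u + ω)(v + θ) = −ad + uv + uθ + vω`
forces `u = v = 0`. [folklore] -/
theorem autToGL_injective (f : BinaryCubic ℤ) : Function.Injective (autToGL f) := by
  rw [injective_iff_map_eq_one]
  intro φ hφ
  have hM : autMatrix φ = 1 := by
    have := congrArg (fun γ : GL (Fin 2) ℤ => (γ : Matrix (Fin 2) (Fin 2) ℤ)) hφ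
    simpa using this
  have h00 : (φ.symm (omega f)).y = 1 := by simpa using congrFun (congrFun hM 0) 0
  have h01 : (φ.symm (omega f)).z = 0 := by simpa using congrFun (congrFun hM 0) 1
  have h10 : (φ.symm (theta f)).y = 0 := by simpa using congrFun (congrFun hM 1) 0
  have h11 : (φ.symm (theta f)).z = 1 := by simpa using congrFun (congrFun hM 1) 1
  -- `φ⁻¹(ω) φ⁻¹(θ) = −ad` forces the `1`-coordinates of `φ⁻¹(ω)`, `φ⁻¹(θ)` to vanish
  have hprod : φ.symm (omega f) * φ.symm (theta f) = ((-(f.a * f.d) : ℤ) : RingOfForm f) := by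
    rw [← map_mul, omega_mul_theta, map_intCast]
  have hv : (φ.symm (theta f)).x = 0 := by
    have h := congrArg RingOfForm.y hprod
    simp only [mul_y, h00, h01, h10, h11, intCast_y] at h
    linarith
  have hu : (φ.symm (omega f)).x = 0 := by
    have h := congrArg RingOfForm.z hprod
    simp only [mul_z, h00, h01, h10, h11, intCast_z] at h
    linarith
  have hω : φ.symm (omega f) = omega f := by
    ext
    · rw [hu]; rfl
    · rw [h00]; rfl
    · rw [h01]; rfl
  have hθ : φ.symm (theta f) = theta f := by
    ext
    · rw [hv]; rfl
    · rw [h10]; rfl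
    · rw [h11]; rfl
  -- so `φ⁻¹ = id`, hence `φ = 1`
  apply RingEquiv.ext
  intro P
  rw [RingAut.one_apply]
  have h := ringHom_apply_of_fix φ.symm hω hθ (φ P)
  rw [RingEquiv.symm_apply_apply] at h
  exact h.symm

/-! ### Surjectivity onto the stabilizer -/

section Realize

variable {R : Type*} [CommRing R]

/-- **Every `γ ∈ GL₂(ℤ)` is a transition matrix**: given a basis `b = (1, b₁, b₂)` and an integral
`γ` with `det γ = ±1`, the vectors `(1, γ₀₀ b₁ + γ₀₁ b₂, γ₁₀ b₁ + γ₁₁ b₂)` form a basis `b'` through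
`1` with `transition b b' = γ`. [folklore] -/
theorem exists_basis_transition_eq (b : Basis (Fin 3) ℤ R) (hb : b 0 = 1) (γ : Matrix (Fin 2) (Fin 2) ℤ)
    (hγ : IsUnit γ.det) :
    ∃ b' : Basis (Fin 3) ℤ R, b' 0 = 1 ∧ b' 1 = γ 0 0 • b 1 + γ 0 1 • b 2 ∧
      b' 2 = γ 1 0 • b 1 + γ 1 1 • b 2 ∧ transition b b' = γ := by
  classical
  -- the block matrix `P = 1 ⊕ γᵀ` (columns = coordinates of the new vectors)
  let P : Matrix (Fin 3) (Fin 3) ℤ := !![1, 0, 0; 0, γ 0 0, γ 1 0; 0, γ 0 1, γ 1 1]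
  have hP : P.det = γ.det := by
    simp [P, Matrix.det_fin_three, Matrix.det_fin_two]
    ring
  have hPu : IsUnit P.det := hP ▸ hγ
  let b' : Basis (Fin 3) ℤ R := b.map (Matrix.toLinearEquiv b P hPu)
  have hb' : ∀ i, b' i = ∑ j, P j i • b j := fun i => by
    simp only [b', Basis.map_apply, Matrix.toLinearEquiv_apply, Matrix.toLin_self]
  have h0 : b' 0 = 1 := by rw [hb', Fin.sum_univ_three]; simp [P, hb]
  have h1 : b' 1 = γ 0 0 • b 1 + γ 0 1 • b 2 := by rw [hb', Fin.sum_univ_three]; simp [P]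
  have h2 : b' 2 = γ 1 0 • b 1 + γ 1 1 • b 2 := by rw [hb', Fin.sum_univ_three]; simp [P]
  have r1 : b.repr (b' 1) = γ 0 0 • Finsupp.single 1 1 + γ 0 1 • Finsupp.single 2 1 := by
    rw [h1]; simp only [map_add, map_zsmul, Basis.repr_self]
  have r2 : b.repr (b' 2) = γ 1 0 • Finsupp.single 1 1 + γ 1 1 • Finsupp.single 2 1 := by
    rw [h2]; simp only [map_add, map_zsmul, Basis.repr_self]
  refine ⟨b', h0, h1, h2, ?_⟩
  ext i j
  fin_cases i <;> fin_cases j <;> simp [transition_apply, r1, r2]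

end Realize

/-- **Surjectivity onto `Stab(f)`**: every `γ ∈ GL₂(ℤ)` with `γ · f = f` is `autMatrix φ` for
some automorphism `φ` of `R(f)`: the basis `b' = (1, γ₀₀ω + γ₀₁θ, γ₁₀ω + γ₁₁θ)` has index form
`γ · f = f`, and the explicit isomorphism `R(f) = R(indexForm b') ≅ R(f)`,
`ω ↦ b'₁ − c'₁₂₂`, `θ ↦ b'₂ − c'₁₂₁`, is an automorphism `φ₀` with `autMatrix φ₀⁻¹ = γ`. [folklore] -/
theorem exists_autMatrix_eq {γ : Matrix (Fin 2) (Fin 2) ℤ} (hγ : IsUnit γ.det) (hfix : twist γ f = f) :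
    ∃ φ : RingAut (RingOfForm f), autMatrix φ = γ := by
  obtain ⟨b', hb'0, hb'1, hb'2, htr⟩ := exists_basis_transition_eq (basis f) basis_zero γ hγ
  -- the index form of `b'` is `γ · f = f`
  have hidx : indexForm b' = f := by
    rw [indexForm_eq_twist_transition (basis f) b' basis_zero hb'0, htr, indexForm_basis, hfix]
  -- the explicit isomorphism `R(indexForm b') ≅ R(f)` and the automorphism `φ₀`
  obtain ⟨e, he⟩ := exists_ringEquiv_indexForm b' hb'0
  set φ₀ : RingAut (RingOfForm f) := (castRingEquiv hidx).symm.trans e with hφ₀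
  refine ⟨φ₀.symm, ?_⟩
  have hω : φ₀ (omega f) = b' 1 - ((b'.repr (b' 1 * b' 2) 2 : ℤ) : RingOfForm f) := by
    change e ((castRingEquiv hidx).symm (omega f)) = _
    rw [he]
    simp
  have hθ : φ₀ (theta f) = b' 2 - ((b'.repr (b' 1 * b' 2) 1 : ℤ) : RingOfForm f) := by
    change e ((castRingEquiv hidx).symm (theta f)) = _
    rw [he]
    simp
  ext i j
  fin_cases i <;> fin_cases j <;> simp [autMatrix, RingEquiv.symm_symm, hω, hθ, hb'1, hb'2, zsmul_eq_mul]

/-- **The image of `Aut(R(f)) → GL₂(ℤ)` is exactly `Stab_{GL₂(ℤ)}(f)`.** [folklore] -/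
theorem range_autToGL (f : BinaryCubic ℤ) : (autToGL f).range = MulAction.stabilizer (GL (Fin 2) ℤ) f := by
  ext γ
  constructor
  · rintro ⟨φ, rfl⟩
    exact autToGL_mem_stabilizer φ
  · intro hγ
    rw [mem_stabilizer_iff_twist] at hγ
    obtain ⟨φ, hφ⟩ := exists_autMatrix_eq (Matrix.isUnits_det_units γ) hγ
    refine ⟨φ, Units.ext ?_⟩
    simp [hφ]

/-- **`Aut(R(f)) ≅ Stab_{GL₂(ℤ)}(f)`** as groups, `φ ↦ autMatrix φ`. [cite: BhargavaTaniguchiThorne2023, Theorem 2.1 (Stab_{GL₂(ℤ)}(f) ≅ Aut(R))] -/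
noncomputable def autEquivStab (f : BinaryCubic ℤ) :
    RingAut (RingOfForm f) ≃* MulAction.stabilizer (GL (Fin 2) ℤ) f :=
  (MulEquiv.ofBijective ((autToGL f).codRestrict _ autToGL_mem_stabilizer)
    ⟨fun φ ψ h => autToGL_injective f (congrArg Subtype.val h),
     fun ⟨γ, hγ⟩ => by
      obtain ⟨φ, hφ⟩ := (range_autToGL f).symm ▸ hγ
      exact ⟨φ, Subtype.ext hφ⟩⟩)

/-- The underlying matrix of `autEquivStab f φ` is `autMatrix φ`. [folklore] -/
@[simp] theorem coe_autEquivStab (φ : RingAut (RingOfForm f)) :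
    (((autEquivStab f φ : MulAction.stabilizer (GL (Fin 2) ℤ) f) : GL (Fin 2) ℤ) : Matrix (Fin 2) (Fin 2) ℤ)
      = autMatrix φ := rfl

/-- **Levi–Delone–Faddeev, the automorphism clause** (BTT 2023, Thm 2.1): for the cubic ring
`R = R(f)` of an integral binary cubic form `f`, `Stab_{GL₂(ℤ)}(f) ≅ Aut(R)` (stabilizer for the
twisted action `(γ · f)(u,v) = det(γ)⁻¹ f((u,v)γ)`). [cite: BhargavaTaniguchiThorne2023, Theorem 2.1 (Stab_{GL₂(ℤ)}(f) is isomorphic to Aut(R))] -/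
noncomputable def stabEquivAut (f : BinaryCubic ℤ) :
    MulAction.stabilizer (GL (Fin 2) ℤ) f ≃* RingAut (RingOfForm f) :=
  (autEquivStab f).symm

/-- In particular `|Stab(f)| = |Aut(R(f))|` (the weights `1/|Stab(x)|` in Shintani's zeta function,
BTT (11), versus `1/|Aut(R)|` in the count of cubic rings, BTT (23)). [folklore] -/
theorem card_stabilizer_eq_card_ringAut (f : BinaryCubic ℤ) :
    Nat.card (MulAction.stabilizer (GL (Fin 2) ℤ) f) = Nat.card (RingAut (RingOfForm f)) :=
  Nat.card_congr (stabEquivAut f).toEquiv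

end RingOfForm

end Literature.NumberTheory.CubicFields
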